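import Summits.ABC.IUTFork.Joshi.TestThetaValuesLocusDictionaryModel
import Summits.ABC.IUTFork.Joshi.TestDictionaryFloor
import Summits.ABC.IUTFork.Joshi.TestLicenceStatementSquare
import HarnessLib

/-!
# TEST vs S: on the cell's exponent census `expSetting p e`, Joshi's label-level volume dictionary PINS `e = (4,4)` — where the
# typed Corollary holds and `S = PilotKummerIndRelated` FAILS; the dictionary and S are MUTUALLY EXCLUSIVE there (kernel; located)

Test file of the abc-iut cell, branch E (rung LADDER-ABC:A2.E; seat abc-iut-E-t3, gen 2; E-PLAN R14: Test files are the only place OUR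
frozen `Cor312*` vocabulary meets Joshi's objects), sequel of `Joshi/TestThetaValuesLocus.lean` (p429558: the dictionaries
`VolumeDictionary` / `PilotTupleVolumeDictionary`, OUR READINGS of [J-IIp] §8.2.2, §8.7–§9.3) and `Joshi/TestThetaValuesLocusDictionaryModel.lean`
(p438097: the label-level dictionary HOLDS at the census member `e ≡ 4` for the renormalised model datum), over abc-iut-w5-d232's
exponent census `Cor312Vol.NaiveWitness.expSetting p e` (`Cor312PinnedGapNotNecessary`: honest Θ-pilot Kummer images `B_{j²}`, q-pilot image
`B_{e_j}`, typed Thm. 3.11 (i)–(iii) of `naiveFull p`, the pins (pΘ)(pq′) for the honest operator `ballOfMonoid`, `BridgeHyps` for EVERY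
`e`; typed Corollary ⟺ `e₁ + e₂ ≥ 5`; Reading R3 ⟺ `e = (1,4)`) and abc-iut-w5-d230's `Cor312Vol.PilotKummerIndRelated` =: **S**
(`Cor312PinnedRegionsThreePins`, p418935; under the pins and Thm. 3.11 (ii)(b) `S ⟺ R3`, `reading3_iff_pilotKummerIndRelated`; on the
census `S ⟺ e = (1,4)` is abc-iut-E-cx's `expSetting_pilotKummerIndRelated_iff`, `Joshi/TestLicenceStatementSquare.lean`, imported BY NAME). Sources:
K. Joshi, arXiv:2303.01662 v3 (`paper:arxiv-2303.01662`, bib `Joshi2023ATS2Local`), UNREFEREED, rejected by the IUT author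
[Mochizuki2024JoshiReport], accepted by neither side of the dispute (D-0012). FRAMING: locates / conditionally verifies; no abc claim;
no side taken on [IUTchIII] Cor. 3.12 or on any author; typed ≠ proved ≠ endorsed. Toy level (one place, `ℓ⋆ = 2`).

## What is shown (kernel)

* `pilotTupleVolumeDictionary_expSetting_exponents` — for EVERY prototype datum `J` with a canonical point, every place and every
  `ρ`: `PilotTupleVolumeDictionary J c (expSetting p e) v_ℚ ρ ⟹ e₁ = 4 ∧ e₂ = 4`. Mechanism: the Θ-clause at label `1` reads
  `logvol(B_1) = −log p = (1/ℓ⋆)²·log|ξ|_0`, so `log|ξ|_0 = −4·log p`; the q-clause (ii) «`qLocal(j) = log|q^{1/2ℓ}| = log|ξ|_0`» is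
  LABEL-CONSTANT (Joshi's q-side is one number), so `−e_j·log p = −4·log p` at both labels. With p438097's instance at `e ≡ 4` this is an
  «iff up to the choice of `J`» (`pilotTupleVolumeDictionary_expSetting_iff_exists`).
* `volumeDictionary_expSetting_exponents` — the hull-level (ii) alone already forces `e₁ = e₂` (and p432781: with a root tower the
  hull-level dictionary never holds on the census).
* **S vs the dictionary** (`not_pilotKummerIndRelated_of_pilotTupleVolumeDictionary`, `not_pilotTupleVolumeDictionary_of_pilotKummerIndRelated`,
  `dictionary_and_S_separate_on_census`): S ⟺ R3 ⟺ `e = (1,4)` has `e₁ ≠ e₂`; the dictionary has `e₁ = e₂ (= 4)`. So on the census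
  the member carrying Joshi's label-level dictionary (`e ≡ 4`: typed Corollary TRUE strictly, `8 ≥ 5`) has `¬S`, `¬R3`, and the unique
  S-member (`e = (1,4)`, the link-identified datum `Ψ`: Corollary ATTAINED) carries NO Joshi dictionary of either level; the HONEST
  q-datum `e ≡ 1` (P♯ / the pinned countermodel's q-side: `¬`Corollary) carries neither.

RUNG CURRENCY (A2.E): «test vs S» for the E-t3 lineage reads: target = Statement, FILLS-MODULO-Y (Y = `VolumeDictionary`, p429558;
Y satisfiable p438097); **S-EXCLUDED on the census** — where OUR reading of Joshi's dictionary holds, the residual S fails, and where S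
holds no dictionary exists (this file). LOCATION, not verdict: a statement about the cell's toy census and OUR dictionary readings,
nothing about print or about which setting the intended situation produces. [claim: Joshi2023ATS2Local, status: disputed]
[cite: ScholzeStix2018, §2.2 pp. 9–10] for the identification form R3.
-/

noncomputable section

open Set

namespace Summit.ABC.IUTFork.Joshi

open Thm311 Cor312 Cor312Vol Cor312Vol.NaiveWitness Cor312Vol.GluedMonoids.Naive Cor312.Checks Cor312.IdentifiedNonVacuity
  Literature.IUT.LogThetaLattice

variable {F B E0 : Type} [Field F] [CommRing B] [Field E0] {Y : Type} {K : Y → Type} [∀ y, Field (K y)] {G : Type}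
  (p : ℕ) [hp : Fact p.Prime] (e : toyIndex.LabelStar → ℕ)

/-! ## 1. What the dictionaries force on the exponent vector -/

/-- Two census exponents with the same local q-term are equal (`log p ≠ 0`). [folklore] -/
theorem exp_eq_of_qLocal_eq {a b : ℕ} (h : -(a : ℝ) * Real.log p = -(b : ℝ) * Real.log p) : a = b := by
  have hl := NaiveWitness.log_p_pos p
  have : (a : ℝ) = b := by nlinarith
  exact_mod_cast this

/-- **The hull-level dictionary's clause (ii) alone forces `e₁ = e₂`** (Joshi's q-side `log|q^{1/2ℓ}|` is one number for all labels).
[claim: Joshi2023ATS2Local, status: disputed] -/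
theorem volumeDictionary_expSetting_exponents {J : PrototypeDatum F B E0 Y K G} {vQ : toyIndex.VQ}
    (D : VolumeDictionary J (expSetting p e) vQ) : e ⟨1, by decide⟩ = e ⟨2, by decide⟩ := by
  have h0 := D.qLocal_eq ⟨0, by decide⟩
  have h1 := D.qLocal_eq ⟨1, by decide⟩
  rw [expSetting_qLocal_labelSucc] at h0 h1
  exact exp_eq_of_qLocal_eq p (h0.trans h1.symm)

/-- Under a label-level dictionary to a census member, `ℓ⋆(J) = 2`. [folklore] -/
theorem lstar_eq_two_of_pilotTupleVolumeDictionary {J : PrototypeDatum F B E0 Y K G} {c : J.CanonicalPoint} {vQ : toyIndex.VQ} {ρ : ℝ}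
    (D : PilotTupleVolumeDictionary J c (expSetting p e) vQ ρ) : (J.lstar : ℝ) = 2 := by
  rw [← D.lstar_eq]
  show ((2 : ℕ) : ℝ) = 2
  norm_num

/-- **The label-level dictionary forces `log|ξ|_0 = −4·log p`** (Θ-clause at label `1`: `logvol(B_1) = −log p = (1/ℓ⋆)²·log|ξ|_0`).
[claim: Joshi2023ATS2Local, status: disputed] -/
theorem log_abs0_xi_of_pilotTupleVolumeDictionary {J : PrototypeDatum F B E0 Y K G} {c : J.CanonicalPoint} {vQ : toyIndex.VQ}
    {ρ : ℝ} (D : PilotTupleVolumeDictionary J c (expSetting p e) vQ ρ) : Real.log (J.abs0 J.xi) = -(4 * Real.log p) := by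
  obtain ⟨m, hm⟩ := D.theta_eq ⟨0, by decide⟩
  have hΘ : ((naiveSituation p).D (expSetting p e).n).logvol (Setting.labelSucc ⟨0, by decide⟩) vQ
      ((expSetting p e).thetaRegion m (Setting.labelSucc ⟨0, by decide⟩) vQ) = -Real.log p := by
    show pVol p _ vQ (pBall p _ vQ (jsq (Setting.labelSucc ⟨0, by decide⟩))) = _
    rw [pVol_pBall]
    have hj : jsq (Setting.labelSucc (T := toyIndex) ⟨0, by decide⟩) = 1 := by decide
    rw [hj]
    simp
  rw [hΘ, c.norm_pilotTuple D.rho_mem.1 D.rho_mem.2, Real.log_rpow J.abs0_xi_pos,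
    lstar_eq_two_of_pilotTupleVolumeDictionary p e D] at hm
  simp only [Fin.val_cast] at hm
  have h0 : ((((⟨0, by decide⟩ : Fin toyIndex.lstar) : ℕ) : ℝ)) = 0 := by norm_num
  rw [h0] at hm
  linarith

/-- **The label-level dictionary PINS the census exponents: `e₁ = 4 ∧ e₂ = 4`.** [claim: Joshi2023ATS2Local, status: disputed] -/
theorem pilotTupleVolumeDictionary_expSetting_exponents {J : PrototypeDatum F B E0 Y K G} {c : J.CanonicalPoint} {vQ : toyIndex.VQ}
    {ρ : ℝ} (D : PilotTupleVolumeDictionary J c (expSetting p e) vQ ρ) : e ⟨1, by decide⟩ = 4 ∧ e ⟨2, by decide⟩ = 4 := by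
  have hξ := log_abs0_xi_of_pilotTupleVolumeDictionary p e D
  have h0 := D.qLocal_eq ⟨0, by decide⟩
  have h1 := D.qLocal_eq ⟨1, by decide⟩
  rw [expSetting_qLocal_labelSucc, hξ] at h0 h1
  have e4 : -((4 : ℕ) : ℝ) * Real.log p = -(4 * Real.log p) := by push_cast; ring
  exact ⟨exp_eq_of_qLocal_eq p (h0.trans e4.symm), exp_eq_of_qLocal_eq p (h1.trans e4.symm)⟩

/-- … and conversely at `e ≡ 4` it holds for the renormalised model datum (p438097): on the census the label-level dictionary is
realisable IFF `e = (4,4)`. [claim: Joshi2023ATS2Local, status: disputed] -/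
theorem pilotTupleVolumeDictionary_expSetting_iff_exists (vQ : toyIndex.VQ) :
    (∃ (J : PrototypeDatum (PadicAlgCl p) (PadicAlgCl p → PadicAlgCl p) (PadicAlgCl p) (PadicAlgCl p) (fun _ => PadicAlgCl p) Unit)
        (c : J.CanonicalPoint) (ρ : ℝ), PilotTupleVolumeDictionary J c (expSetting p e) vQ ρ) ↔
      e = expFour := by
  constructor
  · rintro ⟨J, c, ρ, D⟩
    obtain ⟨h1, h2⟩ := pilotTupleVolumeDictionary_expSetting_exponents p e D
    funext j
    rcases labelStar_cases j with rfl | rfl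
    · exact h1
    · exact h2
  · rintro rfl
    exact ⟨Model.prototypeDatum4 p, Model.canonicalPoint4 p, 1, pilotTupleVolumeDictionary_expFour p vQ one_pos le_rfl⟩

/-! ## 2. S versus the dictionary on the census -/

/-! On the census **S ⟺ `e = (1,4)`** is abc-iut-E-cx's `expSetting_pilotKummerIndRelated_iff` (`Joshi/TestLicenceStatementSquare.lean`,
imported BY NAME: pins + Thm. 3.11 (ii)(b) make S ⟺ Reading R3, w5-d230; R3 ⟺ `e = (1,4)`, w5-d232). -/

/-- **Label-level dictionary ⟹ ¬S** on the census (`e₁ = 4 ≠ 1`). [claim: Joshi2023ATS2Local, status: disputed] -/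
theorem not_pilotKummerIndRelated_of_pilotTupleVolumeDictionary {J : PrototypeDatum F B E0 Y K G} {c : J.CanonicalPoint}
    {vQ : toyIndex.VQ} {ρ : ℝ} (D : PilotTupleVolumeDictionary J c (expSetting p e) vQ ρ) :
    ¬ PilotKummerIndRelated (naiveFull p).toLatticeSituation (expSetting p e) (ballOfMonoid p) fun v _ => qDatumExp p e v := by
  rw [expSetting_pilotKummerIndRelated_iff]
  have h := (pilotTupleVolumeDictionary_expSetting_exponents p e D).1
  omega

/-- **Hull-level dictionary ⟹ ¬S** on the census (`e₁ = e₂` vs `(1,4)`; vacuously strong given p432781, recorded for the shape).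
[claim: Joshi2023ATS2Local, status: disputed] -/
theorem not_pilotKummerIndRelated_of_volumeDictionary {J : PrototypeDatum F B E0 Y K G} {vQ : toyIndex.VQ}
    (D : VolumeDictionary J (expSetting p e) vQ) :
    ¬ PilotKummerIndRelated (naiveFull p).toLatticeSituation (expSetting p e) (ballOfMonoid p) fun v _ => qDatumExp p e v := by
  rw [expSetting_pilotKummerIndRelated_iff]
  have h := volumeDictionary_expSetting_exponents p e D
  omega

/-- **S ⟹ no Joshi dictionary of either level** on the census (contrapositive form, all data universally quantified).
[claim: Joshi2023ATS2Local, status: disputed] -/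
theorem not_dictionary_of_pilotKummerIndRelated
    (hS : PilotKummerIndRelated (naiveFull p).toLatticeSituation (expSetting p e) (ballOfMonoid p) fun v _ => qDatumExp p e v)
    (J : PrototypeDatum F B E0 Y K G) (c : J.CanonicalPoint) (vQ : toyIndex.VQ) (ρ : ℝ) :
    ¬ PilotTupleVolumeDictionary J c (expSetting p e) vQ ρ ∧ ¬ VolumeDictionary J (expSetting p e) vQ :=
  ⟨fun D => not_pilotKummerIndRelated_of_pilotTupleVolumeDictionary p e D hS,
    fun D => not_pilotKummerIndRelated_of_volumeDictionary p e D hS⟩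

/-- Reading R3 fails wherever the label-level dictionary holds. [folklore] -/
theorem not_reading3_of_pilotTupleVolumeDictionary {J : PrototypeDatum F B E0 Y K G} {c : J.CanonicalPoint} {vQ : toyIndex.VQ}
    {ρ : ℝ} (D : PilotTupleVolumeDictionary J c (expSetting p e) vQ ρ) :
    ¬ ∀ (j : toyIndex.Label) (vQ : toyIndex.VQ), (expSetting p e).qRegion j vQ ∈ (expSetting p e).possibleImages j vQ := by
  rw [expSetting_reading3_iff']
  have h := (pilotTupleVolumeDictionary_expSetting_exponents p e D).1
  omega

/-! ## 3. The three corners, packaged -/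

/-- **THE DICTIONARY AND S SEPARATE ON THE CENSUS.** (a) At `e ≡ 4`: the label-level dictionary HOLDS (renormalised model datum,
p438097), the typed Corollary HOLDS (strictly), and S FAILS (with R3). (b) At `e = expSq = (1,4)` (the link-identified datum; `expSq`
of `Joshi/TestDictionaryFloor.lean`, p429619): S HOLDS, the Corollary holds (attained), and NO Joshi dictionary of either level exists for
ANY prototype datum over the model carriers. (c) At the honest
`e ≡ 1` (P♯ = the pinned countermodel's q-side): `¬`Corollary, `¬`S, and no label-level dictionary. Typed Thm. 3.11 (i)–(iii), the pins and
the bridge hypotheses hold throughout (w5-d232). LOCATION on the toy census; no side taken. [claim: Joshi2023ATS2Local, status: disputed] -/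
theorem dictionary_and_S_separate_on_census (vQ : toyIndex.VQ) :
    ((∀ vQ', PilotTupleVolumeDictionary (Model.prototypeDatum4 p) (Model.canonicalPoint4 p) (expSetting p expFour) vQ' 1) ∧
        (expSetting p expFour).Statement ∧
        ¬ PilotKummerIndRelated (naiveFull p).toLatticeSituation (expSetting p expFour) (ballOfMonoid p)
          (fun v _ => qDatumExp p expFour v)) ∧
      (PilotKummerIndRelated (naiveFull p).toLatticeSituation (expSetting p expSq) (ballOfMonoid p)
          (fun v _ => qDatumExp p expSq v) ∧
        (expSetting p expSq).Statement ∧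
        ∀ (J : PrototypeDatum (PadicAlgCl p) (PadicAlgCl p → PadicAlgCl p) (PadicAlgCl p) (PadicAlgCl p) (fun _ => PadicAlgCl p) Unit)
          (c : J.CanonicalPoint) (ρ : ℝ),
          ¬ PilotTupleVolumeDictionary J c (expSetting p expSq) vQ ρ ∧ ¬ VolumeDictionary J (expSetting p expSq) vQ) ∧
      (¬ (expSetting p expOne).Statement ∧
        ¬ PilotKummerIndRelated (naiveFull p).toLatticeSituation (expSetting p expOne) (ballOfMonoid p)
          (fun v _ => qDatumExp p expOne v) ∧
        ∀ (J : PrototypeDatum (PadicAlgCl p) (PadicAlgCl p → PadicAlgCl p) (PadicAlgCl p) (PadicAlgCl p) (fun _ => PadicAlgCl p) Unit)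
          (c : J.CanonicalPoint) (ρ : ℝ), ¬ PilotTupleVolumeDictionary J c (expSetting p expOne) vQ ρ) := by
  have hS : PilotKummerIndRelated (naiveFull p).toLatticeSituation (expSetting p expSq) (ballOfMonoid p)
      (fun v _ => qDatumExp p expSq v) := (expSetting_pilotKummerIndRelated_iff p expSq).2 expSq_eval
  refine ⟨⟨fun vQ' => pilotTupleVolumeDictionary_expFour p vQ' one_pos le_rfl, (expSetting_statement_iff p expFour).2 (by decide),
      not_pilotKummerIndRelated_of_pilotTupleVolumeDictionary p expFour (pilotTupleVolumeDictionary_expFour p vQ one_pos le_rfl)⟩,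
    ⟨hS, (expSetting_statement_iff p expSq).2 (by decide), fun J c ρ => not_dictionary_of_pilotKummerIndRelated p expSq hS J c vQ ρ⟩,
    ⟨fun h => ?_, fun h => ?_, fun J c ρ D => ?_⟩⟩
  · have := (expSetting_statement_iff p expOne).1 h
    revert this
    decide
  · have := ((expSetting_pilotKummerIndRelated_iff p expOne).1 h).2
    revert this
    decide
  · have := (pilotTupleVolumeDictionary_expSetting_exponents p expOne D).1
    revert this
    decide

end Summit.ABC.IUTFork.Joshi

end
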